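import Mathlib
import HarnessLib
import Literature.MathematicalPhysics.QuantumLattice.KohnLuttinger
import Literature.MathematicalPhysics.QuantumLattice.KohnLuttingerFermiCurvePolarIntegral
import Literature.MathematicalPhysics.QuantumLattice.KohnLuttingerChannelStates
import Summits.HubbardSuperconductivity.HubbardSuperconductivity.Theorems.WeakCouplingBCSWcbcsKohnLuttingerB1gReduction
import Summits.HubbardSuperconductivity.HubbardSuperconductivity.Theorems.WeakCouplingBCSWcbcsKohnLuttingerB1gMuWindow
import Summits.HubbardSuperconductivity.HubbardSuperconductivity.Theorems.WeakCouplingBCSWcbcsKohnLuttingerB1gCertificateForm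
import Summits.HubbardSuperconductivity.HubbardSuperconductivity.Theorems.WeakCouplingBCSWcbcsKohnLuttingerB1gNumericalForm
import Summits.HubbardSuperconductivity.HubbardSuperconductivity.Theorems.ChiralWindowCwThesisUFreeAnchor
import Summits.HubbardSuperconductivity.HubbardSuperconductivity.Theorems.ChiralWindowCwKLChiralWindowBlockBounds
import Summits.HubbardSuperconductivity.HubbardSuperconductivity.Theorems.ChiralWindowCwKLChiralWindowCoverLogic

/-!
# Crux `WcbcsBcsConstruction` (stmt-HubbardSuperconductivity-2010), line `ladder-scale-certified-chain`:
# stub (K) `stub_klB1gWindow` — reductions of the Kohn–Luttinger `B₁g` window to a `U = 1` certificate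

Write `ε₀ = squareDispersion 1 0`, `σ_μ = fermiCurveMeasure ε₀ μ`, `χ₀ = lindhardFunction ε₀ μ`,
`Q_μ(ψ) = ∫ ψ(k) (∫ χ₀(k+k') ψ(k') dσ_μ) dσ_μ` and `Λ_U(μ,χ) = channelInf ε₀ μ U χ` (bottom of the pairing form
`⟨ψ, (U + U² χ₀(k+k')) ψ⟩` over the normalised gap functions of the irrep `χ` of `D₄`).  Stub (K) of the line asks for
`a₀, γ, U₁ > 0` with, for every `μ` in the window `W = [-9/10, -3/10]` and every `U ∈ (0, U₁)`,
`Λ_U(μ,B1g) ≤ -a₀U²` and `Λ_U(μ,B1g) + γU² ≤ Λ_U(μ,χ)` for `χ ≠ B1g`.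

The interval-arithmetic certificate itself (support item stmt-HubbardSuperconductivity-0158) is not in the tree; this
file proves that (K) is EXACTLY a `U`-free numerical statement on `W`, using the frame of the `ChiralWindow` route
(all unconditional on the band levels `μ ∈ (-4,0) ⊃ W`):

* `stub_klB1gWindow_of_leading` — the attractivity conjunct is redundant: leading by `γU²` forces
  `Λ_U(μ,B1g) ≤ Λ_U(μ,A2g) - γU² ≤ -γU²`, because every channel bottom is `≤ 0`
  (`CwThesis.stub_channelInfNonpos`, Riemann–Lebesgue); so `a₀ = γ`.
* `stub_klB1gWindow_of_leadingOne` — it suffices to lead at the single coupling `U = 1`: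
  `Λ_1(μ,B1g) + γ ≤ Λ_1(μ,χ)` on `W` for `χ ≠ B1g` gives (K) with `U₁ = 1`
  (`CwThesis.leading_of_certificateOne`: `Λ_U(B1g) = U² Λ_1(B1g)` by mean zero of non-`A1g` states on the
  `D₄`-invariant finite Fermi-curve measure, and `U² Λ_1(χ) ≤ Λ_U(χ)` for `U ≤ 1`).
* `stub_klB1gWindow_of_mu_certificate` — (K) from the 0158-style certificate on `W`: per-channel lower bounds
  `Λ μ χ ≤ Q_μ(ψ)` on the normalised channel states, a normalised `B1g` witness with `Q_μ(ψ) ≤ ΛB μ`, and the gap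
  `ΛB μ + γ ≤ Λ μ χ` (`χ ≠ B1g`).  Compared with `wcbcsKohnLuttingerB1g_of_mu_certificate` the bound on `|χ₀|`
  (Hilbert–Schmidt kernel, `stub_klKernelHS`), the mean-zero condition on the witness (`stub_klMeanZero`) and the
  sign condition `Λ ≤ 0` (non-empty channel-state sets, `nonempty_isChannelState`) are discharged, and no separate
  attractivity constant is needed.
* `stub_klB1gWindow_of_mu_certificate'` — the same with the hypotheses of `wcbcsKohnLuttingerB1g_of_mu_certificate`
  verbatim (window `μ₂ = -9/10`, `μ₁ = -3/10`), for callers holding that certificate.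
* `stub_klB1gWindow_of_klBoxes` — (K) from a finite RATIONAL record in the certificate vocabulary of crux
  `CwKLChiralWindow` (`Theorems/ChiralWindowDefs.lean`: trigonometric trials, Ritz/Temple/far-channel blocks `KLBlock`,
  `μ`-boxes `KLBox`): if a kernel-decidable Boolean test accepts the record (boxes contiguous and covering `W`, inside
  `(-4,0)`, Temple data for `B1g`, a certified lower bound for the four other channels, `b1gLeadsOK` on every box) and
  the block ENCLOSURES `KLBlock.Enclosure` (finitely many explicit integrals against `σ_μ`, uniformly in `μ` on each
  box — the object of interval arithmetic) hold, then (K) follows, by the landed block soundness `stub_klBlockBounds`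
  and the chain cover `kl_cvl_chain_cover`.  This puts (K) on the same footing as the remaining computation of
  stmt-HubbardSuperconductivity-1741: a concrete record checked by `decide` plus certified enclosures.

No definitions.  References: W. Kohn, J. M. Luttinger, Phys. Rev. Lett. 15 (1965) 524; S. Raghu, S. A. Kivelson,
D. J. Scalapino, Phys. Rev. B 81 (2010) 224505 (arXiv:1002.0591) §II (7), (13), §III Fig. 2.
-/

noncomputable section

-- the tree's namespace `Summit.<Summit>.<Problem>.Theorems` repeats the summit name by design (D-0017)
set_option linter.dupNamespace false

namespace Summit.HubbardSuperconductivity.HubbardSuperconductivity.Theorems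

open MeasureTheory Literature.MathematicalPhysics.QuantumLattice Real

/-- The window `[-9/10, -3/10]` lies inside the band levels `(-4, 0)` of `ε₀`. [folklore] -/
theorem klB1gWindow_mem_Ioo {μ : ℝ} (hμ : μ ∈ Set.Icc (-(9:ℝ) / 10) (-(3:ℝ) / 10)) :
    μ ∈ Set.Ioo (-4 : ℝ) 0 :=
  ⟨by linarith [hμ.1], by linarith [hμ.2]⟩

/-- **(K) from leading alone.** If on the window `B1g` leads every other channel by `γU²` for all `U ∈ (0, U₁)`,
then stub (K) holds with `a₀ = γ`: `Λ_U(μ,B1g) + γU² ≤ Λ_U(μ,A2g) ≤ 0` (`CwThesis.stub_channelInfNonpos`).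
[cite: RaghuKivelsonScalapino2010, §II (7) and (13)] -/
theorem stub_klB1gWindow_of_leading {γ U₁ : ℝ} (hγ : 0 < γ) (hU₁ : 0 < U₁)
    (hlead : ∀ μ ∈ Set.Icc (-(9:ℝ) / 10) (-(3:ℝ) / 10), ∀ U ∈ Set.Ioo (0:ℝ) U₁,
      ∀ χ : D4Irrep, χ ≠ D4Irrep.B1g →
        channelInf (squareDispersion 1 0) μ U D4Irrep.B1g + γ * U ^ 2 ≤ channelInf (squareDispersion 1 0) μ U χ) :
    ∃ a₀ γ U₁ : ℝ, 0 < a₀ ∧ 0 < γ ∧ 0 < U₁ ∧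
      ∀ μ ∈ Set.Icc (-(9:ℝ) / 10) (-(3:ℝ) / 10), ∀ U ∈ Set.Ioo (0:ℝ) U₁,
        channelInf (squareDispersion 1 0) μ U D4Irrep.B1g ≤ -(a₀ * U ^ 2) ∧
        ∀ χ : D4Irrep, χ ≠ D4Irrep.B1g →
          channelInf (squareDispersion 1 0) μ U D4Irrep.B1g + γ * U ^ 2 ≤ channelInf (squareDispersion 1 0) μ U χ := by
  refine ⟨γ, γ, U₁, hγ, hγ, hU₁, fun μ hμ U hU => ⟨?_, hlead μ hμ U hU⟩⟩
  have h := hlead μ hμ U hU D4Irrep.A2g (by decide)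
  have h0 := CwThesis.stub_channelInfNonpos U D4Irrep.A2g (klB1gWindow_mem_Ioo hμ)
  linarith

/-- **(K) from the `U = 1` certificate.** If `Λ_1(μ,B1g) + γ ≤ Λ_1(μ,χ)` for every `μ ∈ [-9/10, -3/10]` and every
`χ ≠ B1g`, then stub (K) holds with `a₀ = γ` and `U₁ = 1` (`CwThesis.leading_of_certificateOne`: exact
`U²`-homogeneity of the `B1g` bottom and the bare-`U` penalty `U² Λ_1(χ) ≤ Λ_U(χ)` for `U ≤ 1`).
[cite: RaghuKivelsonScalapino2010, §II (7) and (13)] -/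
theorem stub_klB1gWindow_of_leadingOne {γ : ℝ} (hγ : 0 < γ)
    (hlead : ∀ μ ∈ Set.Icc (-(9:ℝ) / 10) (-(3:ℝ) / 10), ∀ χ : D4Irrep, χ ≠ D4Irrep.B1g →
      channelInf (squareDispersion 1 0) μ 1 D4Irrep.B1g + γ ≤ channelInf (squareDispersion 1 0) μ 1 χ) :
    ∃ a₀ γ U₁ : ℝ, 0 < a₀ ∧ 0 < γ ∧ 0 < U₁ ∧
      ∀ μ ∈ Set.Icc (-(9:ℝ) / 10) (-(3:ℝ) / 10), ∀ U ∈ Set.Ioo (0:ℝ) U₁,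
        channelInf (squareDispersion 1 0) μ U D4Irrep.B1g ≤ -(a₀ * U ^ 2) ∧
        ∀ χ : D4Irrep, χ ≠ D4Irrep.B1g →
          channelInf (squareDispersion 1 0) μ U D4Irrep.B1g + γ * U ^ 2 ≤ channelInf (squareDispersion 1 0) μ U χ :=
  stub_klB1gWindow_of_leading hγ one_pos fun μ hμ U hU χ hχ =>
    CwThesis.leading_of_certificateOne (klB1gWindow_mem_Ioo hμ) (hlead μ hμ) U hU χ hχ

/-- **Lower bound at `U = 1` from a bound on the Lindhard form.** For `μ ∈ (-4,0)`: if `Λ ≤ Q_μ(ψ)` for every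
normalised state of the channel `χ`, then `Λ ≤ Λ_1(μ,χ)` — the channel-state set is non-empty
(`nonempty_isChannelState`) and `⟨ψ, Γ_1 ψ⟩ = (∫ψ dσ)² + Q_μ(ψ) ≥ Q_μ(ψ)` (`klhs_frame_pairingForm_split`,
`stub_klKernelHS`), so no sign condition on `Λ` is needed. [cite: RaghuKivelsonScalapino2010, §II (7)] -/
theorem klB1gWindow_le_channelInf_one {μ Λ : ℝ} (hμ : μ ∈ Set.Ioo (-4 : ℝ) 0) (χ : D4Irrep)
    (hlow : ∀ ψ, IsChannelState (squareDispersion 1 0) μ χ ψ →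
      Λ ≤ ∫ k, ψ k * ∫ k', lindhardFunction (squareDispersion 1 0) μ (k + k') * ψ k'
        ∂fermiCurveMeasure (squareDispersion 1 0) μ ∂fermiCurveMeasure (squareDispersion 1 0) μ) :
    Λ ≤ channelInf (squareDispersion 1 0) μ 1 χ := by
  haveI : IsFiniteMeasure (fermiCurveMeasure (squareDispersion 1 0) μ) :=
    Literature.MathematicalPhysics.QuantumLattice.isFiniteMeasure_fermiCurveMeasure hμ.1 hμ.2
  have hK := stub_klKernelHS μ hμ
  unfold channelInf
  refine le_csInf ((nonempty_isChannelState hμ.1 hμ.2 χ).image _) ?_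
  rintro x ⟨φ, hφ, rfl⟩
  rw [klhs_frame_pairingForm_split 1 hK hφ.1]
  have h := hlow φ hφ
  nlinarith [sq_nonneg (∫ k, φ k ∂fermiCurveMeasure (squareDispersion 1 0) μ)]

/-- **Upper bound at `U = 1` from a witness.** For `μ ∈ (-4,0)` and `χ ≠ A1g`: if the Lindhard form is bounded
below on the normalised states of `χ` and some normalised state has `Q_μ(ψ) ≤ Λ'`, then `Λ_1(μ,χ) ≤ Λ'` — the mean
`∫ψ dσ` vanishes automatically (`stub_klMeanZero` on the `D₄`-invariant finite Fermi-curve measure,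
`stub_klD4Invariant`, `stub_klGradient`). [cite: RaghuKivelsonScalapino2010, §II (7)] -/
theorem klB1gWindow_channelInf_one_le {μ Λ Λ' : ℝ} (hμ : μ ∈ Set.Ioo (-4 : ℝ) 0) {χ : D4Irrep}
    (hχ : χ ≠ D4Irrep.A1g)
    (hlow : ∀ ψ, IsChannelState (squareDispersion 1 0) μ χ ψ →
      Λ ≤ ∫ k, ψ k * ∫ k', lindhardFunction (squareDispersion 1 0) μ (k + k') * ψ k'
        ∂fermiCurveMeasure (squareDispersion 1 0) μ ∂fermiCurveMeasure (squareDispersion 1 0) μ)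
    (hwit : ∃ ψ, IsChannelState (squareDispersion 1 0) μ χ ψ ∧
      ∫ k, ψ k * ∫ k', lindhardFunction (squareDispersion 1 0) μ (k + k') * ψ k'
        ∂fermiCurveMeasure (squareDispersion 1 0) μ ∂fermiCurveMeasure (squareDispersion 1 0) μ ≤ Λ') :
    channelInf (squareDispersion 1 0) μ 1 χ ≤ Λ' := by
  have hfin : IsFiniteMeasure (fermiCurveMeasure (squareDispersion 1 0) μ) :=
    Literature.MathematicalPhysics.QuantumLattice.isFiniteMeasure_fermiCurveMeasure hμ.1 hμ.2
  have hK := stub_klKernelHS μ hμ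
  have hinv := stub_klD4Invariant stub_klGradient μ hμ
  obtain ⟨ψ, hψ, hQ⟩ := hwit
  have hmean : ∫ k, ψ k ∂fermiCurveMeasure (squareDispersion 1 0) μ = 0 :=
    (stub_klMeanZero _ _ hfin hinv χ ψ hχ hψ).2
  have h := channelInf_le_sq_mul_of_hs (le_of_lt one_pos) χ hfin hK hlow ⟨ψ, hψ, hmean, hQ⟩
  simpa using h

/-- **(K) from the 0158-style certificate on the window.** Let `γ > 0` and suppose that for every
`μ ∈ [-9/10, -3/10]`: (iii) `Λ μ χ ≤ Q_μ(ψ)` for every normalised state `ψ` of every channel `χ`; (iv) some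
normalised `B1g` state has `Q_μ(ψ) ≤ ΛB μ`; (v) `ΛB μ + γ ≤ Λ μ χ` for `χ ≠ B1g`.  Then stub (K) holds (with
`a₀ = γ`, `U₁ = 1`): `Λ_1(μ,B1g) + γ ≤ ΛB μ + γ ≤ Λ μ χ ≤ Λ_1(μ,χ)` and `stub_klB1gWindow_of_leadingOne`.  These are
exactly the numerical deliverables of the interval-arithmetic certificate of stmt-HubbardSuperconductivity-0158 on the
chemical-potential window `[-9/10, -3/10]`. [cite: RaghuKivelsonScalapino2010, §III Fig. 2] -/
theorem stub_klB1gWindow_of_mu_certificate {γ : ℝ} {ΛB : ℝ → ℝ} {Λ : ℝ → D4Irrep → ℝ} (hγ : 0 < γ)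
    (hlow : ∀ μ ∈ Set.Icc (-(9:ℝ) / 10) (-(3:ℝ) / 10), ∀ χ : D4Irrep, ∀ ψ,
      IsChannelState (squareDispersion 1 0) μ χ ψ →
      Λ μ χ ≤ ∫ k, ψ k * ∫ k', lindhardFunction (squareDispersion 1 0) μ (k + k') * ψ k'
        ∂fermiCurveMeasure (squareDispersion 1 0) μ ∂fermiCurveMeasure (squareDispersion 1 0) μ)
    (hwit : ∀ μ ∈ Set.Icc (-(9:ℝ) / 10) (-(3:ℝ) / 10), ∃ ψ,
      IsChannelState (squareDispersion 1 0) μ D4Irrep.B1g ψ ∧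
      ∫ k, ψ k * ∫ k', lindhardFunction (squareDispersion 1 0) μ (k + k') * ψ k'
        ∂fermiCurveMeasure (squareDispersion 1 0) μ ∂fermiCurveMeasure (squareDispersion 1 0) μ ≤ ΛB μ)
    (hgap : ∀ μ ∈ Set.Icc (-(9:ℝ) / 10) (-(3:ℝ) / 10), ∀ χ : D4Irrep, χ ≠ D4Irrep.B1g → ΛB μ + γ ≤ Λ μ χ) :
    ∃ a₀ γ U₁ : ℝ, 0 < a₀ ∧ 0 < γ ∧ 0 < U₁ ∧
      ∀ μ ∈ Set.Icc (-(9:ℝ) / 10) (-(3:ℝ) / 10), ∀ U ∈ Set.Ioo (0:ℝ) U₁,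
        channelInf (squareDispersion 1 0) μ U D4Irrep.B1g ≤ -(a₀ * U ^ 2) ∧
        ∀ χ : D4Irrep, χ ≠ D4Irrep.B1g →
          channelInf (squareDispersion 1 0) μ U D4Irrep.B1g + γ * U ^ 2 ≤ channelInf (squareDispersion 1 0) μ U χ := by
  refine stub_klB1gWindow_of_leadingOne hγ fun μ hμW χ hχ => ?_
  have hμ := klB1gWindow_mem_Ioo hμW
  have hup : channelInf (squareDispersion 1 0) μ 1 D4Irrep.B1g ≤ ΛB μ :=
    klB1gWindow_channelInf_one_le hμ (by decide) (hlow μ hμW D4Irrep.B1g) (hwit μ hμW)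
  have hdown : Λ μ χ ≤ channelInf (squareDispersion 1 0) μ 1 χ :=
    klB1gWindow_le_channelInf_one hμ χ (hlow μ hμW χ)
  have h := hgap μ hμW χ hχ
  linarith

/-- **(K) from the certificate of `wcbcsKohnLuttingerB1g_of_mu_certificate`, verbatim, on the window
`μ₂ = -9/10 < μ₁ = -3/10`.** Hypotheses (ii) `|χ₀(k+k')| ≤ C μ` on `F_μ + F_μ`, (iii) per-channel lower bounds,
(iv) a normalised mean-zero `B1g` witness with `Q_μ ≤ ΛB μ`, (v) `ΛB μ + γ ≤ Λ μ χ ≤ 0` for `χ ≠ B1g`; of these (ii), the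
mean-zero clause of (iv) and the sign clause of (v) are not used (`stub_klB1gWindow_of_mu_certificate`), but the same
data then serve both the route item 0158 (doping window `[1 - n(-3/10), 1 - n(-9/10)]`) and stub (K).
[cite: RaghuKivelsonScalapino2010, §III Fig. 2] -/
theorem stub_klB1gWindow_of_mu_certificate' {γ : ℝ} {C ΛB : ℝ → ℝ} {Λ : ℝ → D4Irrep → ℝ} (hγ : 0 < γ)
    (hcert :
      (∀ μ ∈ Set.Icc (-(9:ℝ) / 10) (-(3:ℝ) / 10),
        ∀ k ∈ fermiCurve (squareDispersion 1 0) μ, ∀ k' ∈ fermiCurve (squareDispersion 1 0) μ,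
          |lindhardFunction (squareDispersion 1 0) μ (k + k')| ≤ C μ) ∧
      (∀ μ ∈ Set.Icc (-(9:ℝ) / 10) (-(3:ℝ) / 10), ∀ χ : D4Irrep, ∀ ψ,
        IsChannelState (squareDispersion 1 0) μ χ ψ →
        Λ μ χ ≤ ∫ k, ψ k * ∫ k', lindhardFunction (squareDispersion 1 0) μ (k + k') * ψ k'
          ∂fermiCurveMeasure (squareDispersion 1 0) μ ∂fermiCurveMeasure (squareDispersion 1 0) μ) ∧
      (∀ μ ∈ Set.Icc (-(9:ℝ) / 10) (-(3:ℝ) / 10), ∃ ψ,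
        IsChannelState (squareDispersion 1 0) μ D4Irrep.B1g ψ ∧
        ∫ k, ψ k ∂fermiCurveMeasure (squareDispersion 1 0) μ = 0 ∧
        ∫ k, ψ k * ∫ k', lindhardFunction (squareDispersion 1 0) μ (k + k') * ψ k'
          ∂fermiCurveMeasure (squareDispersion 1 0) μ ∂fermiCurveMeasure (squareDispersion 1 0) μ ≤ ΛB μ) ∧
      (∀ μ ∈ Set.Icc (-(9:ℝ) / 10) (-(3:ℝ) / 10), ∀ χ : D4Irrep, χ ≠ D4Irrep.B1g → ΛB μ + γ ≤ Λ μ χ) ∧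
      (∀ μ ∈ Set.Icc (-(9:ℝ) / 10) (-(3:ℝ) / 10), ∀ χ : D4Irrep, χ ≠ D4Irrep.B1g → Λ μ χ ≤ 0)) :
    ∃ a₀ γ U₁ : ℝ, 0 < a₀ ∧ 0 < γ ∧ 0 < U₁ ∧
      ∀ μ ∈ Set.Icc (-(9:ℝ) / 10) (-(3:ℝ) / 10), ∀ U ∈ Set.Ioo (0:ℝ) U₁,
        channelInf (squareDispersion 1 0) μ U D4Irrep.B1g ≤ -(a₀ * U ^ 2) ∧
        ∀ χ : D4Irrep, χ ≠ D4Irrep.B1g →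
          channelInf (squareDispersion 1 0) μ U D4Irrep.B1g + γ * U ^ 2 ≤ channelInf (squareDispersion 1 0) μ U χ := by
  obtain ⟨-, hlow, hwit, hgap, -⟩ := hcert
  exact stub_klB1gWindow_of_mu_certificate hγ hlow
    (fun μ hμ => (hwit μ hμ).imp fun ψ h => ⟨h.1, h.2.2⟩) hgap

/-! ### (K) from a rational record in the `CwKLChiralWindow` certificate vocabulary -/

open CwKLChiralWindow in
/-- **(K) from block certificates on boxes covering the window.** Let `tab` be a table of trigonometric polynomials,
`boxes` a list of `μ`-boxes with their five channel blocks (`Theorems/ChiralWindowDefs.lean`) and `γ : ℚ`.  Suppose the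
Boolean test accepts: `0 < γ`; the first box starts at or below `-9/10`, the last ends at or above `-3/10`, consecutive
boxes touch or overlap (`KLCert.chainOK`); every box lies in `(-4, 0)`, carries Temple data for `B1g` (`templeOK`), a
certified lower bound for `A1g, A2g, B2g, E` (`lowerOK`), and passes `b1gLeadsOK` (`upper_B1g + γ ≤ lower_χ`).  Suppose
the block enclosures `KLBlock.Enclosure` hold on every box, uniformly in `μ`.  Then stub (K) holds (`a₀ = γ`, `U₁ = 1`):
on the box containing `μ` (`kl_cvl_chain_cover`), `Λ_1(μ,B1g) ≤ upper_B1g` and `lower_χ ≤ Λ_1(μ,χ)`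
(`stub_klBlockBounds`: Ritz/Temple/far-channel soundness), whence `Λ_1(μ,B1g) + γ ≤ Λ_1(μ,χ)` and
`stub_klB1gWindow_of_leadingOne`.  For a concrete record the Boolean hypothesis is `by decide`; the enclosures are the
interval-arithmetic deliverable. [cite: ReedSimonIV1978, Thm. XIII.5] -/
theorem stub_klB1gWindow_of_klBoxes (tab : List KLTrig) (boxes : List KLBox) (γ : ℚ)
    (hcheck : (decide (0 < γ) &&
      (match boxes.head?, boxes.getLast? with
        | some b₀, some b₁ => decide (b₀.mulo ≤ -9 / 10) && decide (-3 / 10 ≤ b₁.muhi)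
        | _, _ => false) &&
      KLCert.chainOK boxes &&
      boxes.all (fun bx => decide (-4 < bx.mulo) && decide (bx.muhi < 0) &&
        bx.bB1g.templeOK tab .B1g && bx.bA1g.lowerOK tab .A1g && bx.bA2g.lowerOK tab .A2g &&
        bx.bB2g.lowerOK tab .B2g && bx.bE.lowerOK tab .E && bx.b1gLeadsOK tab γ)) = true)
    (hE : ∀ bx ∈ boxes, ∀ μ ∈ Set.Icc ((bx.mulo : ℚ) : ℝ) ((bx.muhi : ℚ) : ℝ), ∀ χ : D4Irrep,
      (bx.blk χ).Enclosure tab μ χ) :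
    ∃ a₀ γ U₁ : ℝ, 0 < a₀ ∧ 0 < γ ∧ 0 < U₁ ∧
      ∀ μ ∈ Set.Icc (-(9:ℝ) / 10) (-(3:ℝ) / 10), ∀ U ∈ Set.Ioo (0:ℝ) U₁,
        channelInf (squareDispersion 1 0) μ U D4Irrep.B1g ≤ -(a₀ * U ^ 2) ∧
        ∀ χ : D4Irrep, χ ≠ D4Irrep.B1g →
          channelInf (squareDispersion 1 0) μ U D4Irrep.B1g + γ * U ^ 2 ≤ channelInf (squareDispersion 1 0) μ U χ := by
  simp only [Bool.and_eq_true, decide_eq_true_eq] at hcheck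
  obtain ⟨⟨⟨hγ, hmatch⟩, hchain⟩, hall⟩ := hcheck
  -- every `μ` of the window lies in some box
  have hcover : ∀ μ ∈ Set.Icc (-(9:ℝ) / 10) (-(3:ℝ) / 10),
      ∃ bx ∈ boxes, ((bx.mulo : ℚ) : ℝ) ≤ μ ∧ μ ≤ ((bx.muhi : ℚ) : ℝ) := by
    intro μ hμ
    split at hmatch
    · rename_i b₀ b₁ hb₀ hb₁
      simp only [Bool.and_eq_true, decide_eq_true_eq] at hmatch
      obtain ⟨L, hL⟩ := List.head?_eq_some_iff.1 hb₀
      rw [hL] at hchain hb₁ ⊢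
      have hlo : ((b₀.mulo : ℚ) : ℝ) ≤ μ := by
        have h : ((b₀.mulo : ℚ) : ℝ) ≤ (((-9 / 10 : ℚ)) : ℝ) := by exact_mod_cast hmatch.1
        exact h.trans (by push_cast; linarith [hμ.1])
      have hhi : μ ≤ ((b₁.muhi : ℚ) : ℝ) := by
        have h : (((-3 / 10 : ℚ)) : ℝ) ≤ ((b₁.muhi : ℚ) : ℝ) := by exact_mod_cast hmatch.2
        exact le_trans (by push_cast; linarith [hμ.2]) h
      exact kl_cvl_chain_cover L b₀ b₁ hchain hb₁ μ hlo hhi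
    · exact absurd hmatch Bool.false_ne_true
  refine stub_klB1gWindow_of_leadingOne (γ := ((γ : ℚ) : ℝ)) (by exact_mod_cast hγ) fun μ hμW χ hχ => ?_
  have hμ := klB1gWindow_mem_Ioo hμW
  obtain ⟨bx, hbx, hlo, hhi⟩ := hcover μ hμW
  have hμbx : μ ∈ Set.Icc ((bx.mulo : ℚ) : ℝ) ((bx.muhi : ℚ) : ℝ) := ⟨hlo, hhi⟩
  have hflags := List.all_eq_true.1 hall bx hbx
  simp only [Bool.and_eq_true, decide_eq_true_eq] at hflags
  obtain ⟨⟨⟨⟨⟨⟨⟨-, -⟩, htB⟩, hlA1⟩, hlA2⟩, hlB2⟩, hlE⟩, hlead⟩ := hflags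
  have hl : bx.bB1g.upper + γ ≤ bx.bA1g.lower tab .A1g ∧ bx.bB1g.upper + γ ≤ bx.bA2g.lower tab .A2g ∧
      bx.bB1g.upper + γ ≤ bx.bB2g.lower tab .B2g ∧ bx.bB1g.upper + γ ≤ bx.bE.lower tab .E := by
    simpa only [KLBox.b1gLeadsOK, Bool.and_eq_true, decide_eq_true_eq, and_assoc] using hlead
  obtain ⟨hA1, hA2, hB2, hEE⟩ := hl
  have hEμ : ∀ χ' : D4Irrep, (bx.blk χ').Enclosure tab μ χ' := hE bx hbx μ hμbx
  -- Ritz upper bound for `B1g`, certified lower bound for `χ`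
  have hupB : channelInf (squareDispersion 1 0) μ 1 D4Irrep.B1g ≤ ((bx.bB1g.upper : ℚ) : ℝ) :=
    (stub_klBlockBounds μ hμ bx.bB1g tab D4Irrep.B1g (hEμ D4Irrep.B1g)).2 htB (Or.inr (by decide))
  have hlow : ∀ χ' : D4Irrep, (bx.blk χ').lowerOK tab χ' = true →
      (((bx.blk χ').lower tab χ' : ℚ) : ℝ) ≤ channelInf (squareDispersion 1 0) μ 1 χ' := fun χ' h =>
    (stub_klBlockBounds μ hμ (bx.blk χ') tab χ' (hEμ χ')).1 h
  cases χ with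
  | A1g =>
    calc channelInf (squareDispersion 1 0) μ 1 D4Irrep.B1g + ((γ : ℚ) : ℝ)
        ≤ ((bx.bB1g.upper : ℚ) : ℝ) + ((γ : ℚ) : ℝ) := add_le_add hupB le_rfl
      _ ≤ ((bx.bA1g.lower tab .A1g : ℚ) : ℝ) := by exact_mod_cast hA1
      _ ≤ _ := hlow D4Irrep.A1g hlA1
  | A2g =>
    calc channelInf (squareDispersion 1 0) μ 1 D4Irrep.B1g + ((γ : ℚ) : ℝ)
        ≤ ((bx.bB1g.upper : ℚ) : ℝ) + ((γ : ℚ) : ℝ) := add_le_add hupB le_rfl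
      _ ≤ ((bx.bA2g.lower tab .A2g : ℚ) : ℝ) := by exact_mod_cast hA2
      _ ≤ _ := hlow D4Irrep.A2g hlA2
  | B1g => exact absurd rfl hχ
  | B2g =>
    calc channelInf (squareDispersion 1 0) μ 1 D4Irrep.B1g + ((γ : ℚ) : ℝ)
        ≤ ((bx.bB1g.upper : ℚ) : ℝ) + ((γ : ℚ) : ℝ) := add_le_add hupB le_rfl
      _ ≤ ((bx.bB2g.lower tab .B2g : ℚ) : ℝ) := by exact_mod_cast hB2
      _ ≤ _ := hlow D4Irrep.B2g hlB2
  | E =>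
    calc channelInf (squareDispersion 1 0) μ 1 D4Irrep.B1g + ((γ : ℚ) : ℝ)
        ≤ ((bx.bB1g.upper : ℚ) : ℝ) + ((γ : ℚ) : ℝ) := add_le_add hupB le_rfl
      _ ≤ ((bx.bE.lower tab .E : ℚ) : ℝ) := by exact_mod_cast hEE
      _ ≤ _ := hlow D4Irrep.E hlE

end Summit.HubbardSuperconductivity.HubbardSuperconductivity.Theorems

end
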